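import Literature.RepresentationTheory.HeisenbergGroup.MetaplecticImplementerConjugation
import Literature.NumberTheory.Automorphic.LocalSchwartzBruhatDirectSum
import HarnessLib

/-!
# Quasi-invariant functionals transported onto Siegel unipotents: the eigen-hypotheses of the quadric-support lemma
# (glue P5 → P6 of the support-form proof of `rankOne_theta_lines_disjoint`)

Topic `RepresentationTheory/HeisenbergGroup`; namespace `Literature.RepresentationTheory.HeisenbergGroup`.  THEOREMS ONLY
(no definition, no named fact, no `sorry`).  Sequel of `MetaplecticImplementerConjugation` ([MoeglinVignerasWaldspurger1987,
Chap. 2 II.1 (A), II.6]): there, for the Schrödinger model `ρ = schrodingerSB β ψ` on `𝒮(X)` with implementers unique up to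
scalar (`hU`), a pair `q = (g₀, M₀) ∈ S̃p_ψ(W)`, an element `p = (g, U)` with `g₀ g g₀⁻¹ = n(b)` a Siegel unipotent, and a
functional `Λ` with `Λ ∘ U = κ Λ`, the transported functional `D := Λ ∘ M₀⁻¹` satisfies `D(ψ(−½β(·, b·))·f) = (cκ) D(f)`
(`MpPsi.exists_functional_conj_unipotent`).  This file turns that into the LITERAL hypotheses of the quadric-support /
uncertainty lemma `SchwartzBruhatQuadricUncertainty.eq_zero_of_quadric_eigen_of_partialFourier_quadric_eigen`:

* §1 `exists_eigen_of_conj_unipotentSp` — pointwise form: for `Φ, Ψ ∈ 𝒮(X)` with `Ψ(x) = ψ(−½β(x, b x)) Φ(x)`,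
  `D Ψ = (cκ) · D Φ`.
* §2 `exists_eigen_of_conj_weyl_unipotentSp` — **the partial-Fourier side**: if instead `g₀ g' g₀⁻¹ = w n(b) w⁻¹` for an
  element `w` IMPLEMENTED by an automorphism `ℱ` of `𝒮(X)` (`Implements ρ (ofSymplectic w) ℱ` — e.g. a partial Fourier
  transform implementing a partial Weyl element), then `ℱ ∘ (ψ(−½β(·,b·))·) ∘ ℱ⁻¹` implements `g₀ g' g₀⁻¹`
  (`Implements.mul/.inv`) and `MpPsi.exists_functional_conj_eq_smul` gives `D(ℱ Ψ) = (cκ') · D(ℱ Φ)` for the same `Φ, Ψ`.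
* §3 coordinates `X = R^ι`, a splitting `e : ι₁ ⊕ ι₂ ≃ ι` (`resL`, `glue` of `LocalSchwartzBruhatDirectSum`) and a symmetric
  `c₀ : X →ₗ Y` SUPPORTED ON THE `ι₁`-BLOCK (`β(x, c₀ x) = β(x̃, c₀ x̃)`, `x̃ := (x|ι₁) ⊔ 0`): for a FAMILY `t ↦ p t`
  (a root subgroup) with `g₀ · π(p t) · g₀⁻¹ = n(t • c₀)` resp. `= w n(t • c₀) w⁻¹`, and `Λ` an eigenvector of every
  `op(p t)`, the functional `D` satisfies
  `∀ t, ∃ κ, ∀ Φ Ψ, (∀ x, Ψ x = ψ(t · Q(x|ι₁)) Φ x) → D Ψ = κ D Φ`      (`eigen_family_of_conj_unipotentSp`)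
  resp. the same for `D ∘ ℱ`                                               (`eigen_family_of_conj_weyl_unipotentSp`)
  with the second-degree function `Q ξ := −½ β(ξ ⊔ 0, c₀ (ξ ⊔ 0))` on `R^{ι₁}` — VERBATIM the hypotheses `hD` / `hDF` of the
  uncertainty lemma; `exists_quadraticForm_coe_eq` records that `Q` is (the coercion of) a `QuadraticForm R (ι₁ → R)`.

Use (cell hodgecm-mathlib, row IV-4(c1), KEY `b4-rank-one-theta-lines-disjoint`, P7): `ρ` the doubled model
`localSchrodinger F (3+3) (gramD F 3 T) v`, `q` the polarisation mover (P4), `p t = 𝔻(n_t(r))` / `p' t = 𝔻(n_t(r'))` the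
diagonally doubled root subgroups of an isotropic vector and of its hyperbolic partner (P2), `(w, ℱ)` the partial Weyl element
and its partial Fourier transform (P5(c)), `Q` the anisotropic quaternary forms of P3.  Nothing about unitary groups is in
this file.

## References
* [MoeglinVignerasWaldspurger1987] C. Mœglin, M.-F. Vignéras, J.-L. Waldspurger, *Correspondances de Howe sur un corps
  p-adique*, LNM 1291 (1987), Chap. 2 II.1 (A), II.6.
* [Weil1964] A. Weil, *Sur certains groupes d'opérateurs unitaires*, Acta Math. 111 (1964), n° 13, p. 160.
-/

set_option autoImplicit false

noncomputable section

namespace Literature.RepresentationTheory.HeisenbergGroup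

open Literature.NumberTheory.Automorphic

section Schrodinger

variable {R : Type*} [CommRing R] [Invertible (2 : R)] {X Y : Type*} [AddCommGroup X] [Module R X] [AddCommGroup Y]
  [Module R Y] (β : X →ₗ[R] Y →ₗ[R] R) (ψ : AddChar R Circle)
variable [TopologicalSpace X] [TopologicalSpace R] [IsTopologicalAddGroup X] [ContinuousNeg R]
  (hψ : IsLocallyConstant (⇑ψ : R → Circle)) (hβ : ∀ y : Y, Continuous fun u : X => β u y)

omit [IsTopologicalAddGroup X] in
/-- two Schwartz–Bruhat functions related pointwise by the second-degree character ARE related by the unipotent operator: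
`Ψ = unipotentEquivSB ψ (½β(·, b·)) Φ`. [cite: Weil1964, n° 13, p. 160] -/
theorem eq_unipotentEquivSB_of_pointwise (b : X →ₗ[R] Y) (hq : Continuous fun x : X => ⅟(2 : R) * β x (b x))
    (Φ Ψ : SchwartzBruhat X)
    (hΦΨ : ∀ x, (Ψ : X → ℂ) x = ((ψ (-(⅟(2 : R) * β x (b x))) : Circle) : ℂ) * (Φ : X → ℂ) x) :
    Ψ = unipotentEquivSB ψ hψ (fun x : X => ⅟(2 : R) * β x (b x)) hq Φ := by
  apply Subtype.ext
  funext x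
  rw [hΦΨ, coe_unipotentEquivSB, unipotentOp_apply]

/-! ## §1 The Siegel-lower side, pointwise -/

/-- **`D Ψ = (cκ) D Φ` whenever `Ψ = ψ(−½β(·, b·)) Φ`** (`D = Λ ∘ M₀⁻¹`, `g₀ g g₀⁻¹ = n(b)`, `Λ ∘ U = κ Λ`).
[cite: MoeglinVignerasWaldspurger1987, Chap. 2 II.1 (A), II.6] -/
theorem exists_eigen_of_conj_unipotentSp (hU : ImplementerUniqueUpToScalar (schrodingerSB β ψ hψ hβ))
    (q p : MpPsi (schrodingerSB β ψ hψ hβ)) (b : X →ₗ[R] Y) (hb : ∀ x x', β x (b x') = β x' (b x))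
    (hq : Continuous fun x : X => ⅟(2 : R) * β x (b x))
    (h : MpPsi.proj _ q * MpPsi.proj _ p * (MpPsi.proj _ q)⁻¹ = unipotentSp β b hb)
    (Λ : SchwartzBruhat X →ₗ[ℂ] ℂ) (κ : ℂ) (hΛ : ∀ f : SchwartzBruhat X, Λ (MpPsi.toOp _ p f) = κ • Λ f) :
    ∃ c : ℂˣ, ∀ Φ Ψ : SchwartzBruhat X,
      (∀ x, (Ψ : X → ℂ) x = ((ψ (-(⅟(2 : R) * β x (b x))) : Circle) : ℂ) * (Φ : X → ℂ) x) →
        Λ ((MpPsi.toOp _ q).symm Ψ) = ((c : ℂ) * κ) * Λ ((MpPsi.toOp _ q).symm Φ) := by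
  obtain ⟨c, hc⟩ := MpPsi.exists_functional_conj_unipotent β ψ hψ hβ hU q p b hb hq h Λ κ hΛ
  refine ⟨c, fun Φ Ψ hΦΨ => ?_⟩
  rw [eq_unipotentEquivSB_of_pointwise β ψ hψ b hq Φ Ψ hΦΨ, hc Φ, smul_eq_mul]

/-! ## §2 The partial-Fourier side, pointwise -/

/-- **conjugates landing on `w n(b) w⁻¹` with `w` implemented by `ℱ`**: `ℱ ∘ (ψ(−½β(·,b·))·) ∘ ℱ⁻¹` implements
`g₀ g' g₀⁻¹`, hence `D(ℱ(ψ(−½β(·,b·)) f)) = (cκ) · D(ℱ f)` for `D = Λ ∘ M₀⁻¹`, `Λ ∘ U' = κ Λ`.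
[cite: MoeglinVignerasWaldspurger1987, Chap. 2 II.1 (A), II.6] -/
theorem exists_functional_conj_weyl_unipotent (hU : ImplementerUniqueUpToScalar (schrodingerSB β ψ hψ hβ))
    (q p : MpPsi (schrodingerSB β ψ hψ hβ)) (w : symplecticGroup (polar β))
    (ℱ : SchwartzBruhat X ≃ₗ[ℂ] SchwartzBruhat X) (hwF : Implements (schrodingerSB β ψ hψ hβ) (ofSymplectic (polar β) w) ℱ)
    (b : X →ₗ[R] Y) (hb : ∀ x x', β x (b x') = β x' (b x)) (hq : Continuous fun x : X => ⅟(2 : R) * β x (b x))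
    (h : MpPsi.proj _ q * MpPsi.proj _ p * (MpPsi.proj _ q)⁻¹ = w * unipotentSp β b hb * w⁻¹)
    {M : Type*} [AddCommGroup M] [Module ℂ M] (Λ : SchwartzBruhat X →ₗ[ℂ] M) (κ : ℂ)
    (hΛ : ∀ f : SchwartzBruhat X, Λ (MpPsi.toOp _ p f) = κ • Λ f) :
    ∃ c : ℂˣ, ∀ f : SchwartzBruhat X,
      Λ ((MpPsi.toOp _ q).symm (ℱ (unipotentEquivSB ψ hψ (fun x : X => ⅟(2 : R) * β x (b x)) hq f))) =
        ((c : ℂ) * κ) • Λ ((MpPsi.toOp _ q).symm (ℱ f)) := by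
  have hN := unipotent_mem_MpPsi β ψ hψ hβ b hb hq
  rw [mem_MpPsi] at hN
  have hI : Implements (schrodingerSB β ψ hψ hβ)
      (ofSymplectic (polar β) (MpPsi.proj _ q * MpPsi.proj _ p * (MpPsi.proj _ q)⁻¹))
      (ℱ * unipotentEquivSB ψ hψ (fun x : X => ⅟(2 : R) * β x (b x)) hq * ℱ⁻¹) := by
    rw [h, map_mul, map_mul, map_inv]
    exact Implements.mul _ (Implements.mul _ hwF hN) (Implements.inv _ hwF)
  obtain ⟨c, hc⟩ := MpPsi.exists_functional_conj_eq_smul _ hU q p hI Λ κ hΛ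
  refine ⟨c, fun f => ?_⟩
  have := hc (ℱ f)
  rw [LinearEquiv.mul_apply, LinearEquiv.mul_apply, LinearEquiv.coe_inv, LinearEquiv.symm_apply_apply] at this
  exact this

/-- pointwise form of `exists_functional_conj_weyl_unipotent`: **`D(ℱ Ψ) = (cκ) D(ℱ Φ)` whenever
`Ψ = ψ(−½β(·, b·)) Φ`**. [cite: MoeglinVignerasWaldspurger1987, Chap. 2 II.1 (A), II.6] -/
theorem exists_eigen_of_conj_weyl_unipotentSp (hU : ImplementerUniqueUpToScalar (schrodingerSB β ψ hψ hβ))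
    (q p : MpPsi (schrodingerSB β ψ hψ hβ)) (w : symplecticGroup (polar β))
    (ℱ : SchwartzBruhat X ≃ₗ[ℂ] SchwartzBruhat X) (hwF : Implements (schrodingerSB β ψ hψ hβ) (ofSymplectic (polar β) w) ℱ)
    (b : X →ₗ[R] Y) (hb : ∀ x x', β x (b x') = β x' (b x)) (hq : Continuous fun x : X => ⅟(2 : R) * β x (b x))
    (h : MpPsi.proj _ q * MpPsi.proj _ p * (MpPsi.proj _ q)⁻¹ = w * unipotentSp β b hb * w⁻¹)
    (Λ : SchwartzBruhat X →ₗ[ℂ] ℂ) (κ : ℂ) (hΛ : ∀ f : SchwartzBruhat X, Λ (MpPsi.toOp _ p f) = κ • Λ f) :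
    ∃ c : ℂˣ, ∀ Φ Ψ : SchwartzBruhat X,
      (∀ x, (Ψ : X → ℂ) x = ((ψ (-(⅟(2 : R) * β x (b x))) : Circle) : ℂ) * (Φ : X → ℂ) x) →
        Λ ((MpPsi.toOp _ q).symm (ℱ Ψ)) = ((c : ℂ) * κ) * Λ ((MpPsi.toOp _ q).symm (ℱ Φ)) := by
  obtain ⟨c, hc⟩ := exists_functional_conj_weyl_unipotent β ψ hψ hβ hU q p w ℱ hwF b hb hq h Λ κ hΛ
  refine ⟨c, fun Φ Ψ hΦΨ => ?_⟩
  rw [eq_unipotentEquivSB_of_pointwise β ψ hψ b hq Φ Ψ hΦΨ, hc Φ, smul_eq_mul]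

end Schrodinger

/-! ## §3 Coordinates: a symmetric `c₀` supported on the `ι₁`-block and a root family `t ↦ p t` -/

section Coordinates

variable {R : Type*} [CommRing R] [Invertible (2 : R)] [TopologicalSpace R] [IsTopologicalRing R]
  {ι ι₁ ι₂ : Type*} (e : ι₁ ⊕ ι₂ ≃ ι)
  {Y : Type*} [AddCommGroup Y] [Module R Y] (β : (ι → R) →ₗ[R] Y →ₗ[R] R) (ψ : AddChar R Circle)
  (hψ : IsLocallyConstant (⇑ψ : R → Circle)) (hβ : ∀ y : Y, Continuous fun u : (ι → R) => β u y)
  (c₀ : (ι → R) →ₗ[R] Y) (hc₀ : ∀ x x', β x (c₀ x') = β x' (c₀ x))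
  (hsupp : ∀ x : ι → R, β x (c₀ x) = β (glue e (resL e x) 0) (c₀ (glue e (resL e x) 0)))
  (hq : ∀ t : R, Continuous fun x : ι → R => ⅟(2 : R) * β x ((t • c₀) x))

omit [Invertible (2 : R)] [TopologicalSpace R] [IsTopologicalRing R] in
include hc₀ in
/-- `t • c₀` is `β`-symmetric when `c₀` is. [cite: Weil1964, n° 6, p. 151] -/
theorem symm_smul_of_symm (t : R) (x x' : ι → R) : β x ((t • c₀) x') = β x' ((t • c₀) x) := by
  rw [LinearMap.smul_apply, LinearMap.smul_apply, map_smul, map_smul, hc₀]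

omit [TopologicalSpace R] [IsTopologicalRing R] in
include hsupp in
/-- the second-degree character of `n(t • c₀)` read in the `ι₁`-variables: `−½β(x, (t•c₀) x) = t · Q(x|ι₁)` with
`Q ξ := −½ β(ξ ⊔ 0, c₀ (ξ ⊔ 0))`. [cite: Weil1964, n° 13, p. 160] -/
theorem neg_half_smul_eq_mul_resL (t : R) (x : ι → R) :
    -(⅟(2 : R) * β x ((t • c₀) x)) =
      t * -(⅟(2 : R) * β (glue e (resL e x) 0) (c₀ (glue e (resL e x) 0))) := by
  rw [LinearMap.smul_apply, map_smul, smul_eq_mul, hsupp]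
  ring

omit [TopologicalSpace R] [IsTopologicalRing R] in
/-- **the second-degree function `Q ξ = −½ β(ξ ⊔ 0, c₀ (ξ ⊔ 0))` on `R^{ι₁}` is a quadratic form** (coercion of a Mathlib
`QuadraticForm`, so that `QuadraticMap.levelSet_subset_piPrimePowBall_of_anisotropic` /
`interior_levelSet_eq_empty_of_anisotropic` apply to it). [cite: Weil1964, n° 13, p. 160] -/
theorem exists_quadraticForm_coe_eq :
    ∃ Qf : QuadraticForm R (ι₁ → R),
      (⇑Qf : (ι₁ → R) → R) = fun ξ => -(⅟(2 : R) * β (glue e ξ 0) (c₀ (glue e ξ 0))) := by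
  classical
  -- the zero-extension `ξ ↦ ξ ⊔ 0` as a linear map
  let L : (ι₁ → R) →ₗ[R] (ι → R) :=
    { toFun := fun ξ => glue e ξ 0
      map_add' := fun ξ ξ' => by rw [glue_add, add_zero]
      map_smul' := fun a ξ => by
        funext k
        obtain ⟨s, rfl⟩ := e.surjective k
        rcases s with i | j
        · simp
        · simp }
  have hL : ∀ ξ, L ξ = glue e ξ 0 := fun _ => rfl
  refine ⟨LinearMap.BilinMap.toQuadraticMap ((-⅟(2 : R)) • (β.compl₁₂ L (c₀ ∘ₗ L))), funext fun ξ => ?_⟩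
  rw [LinearMap.BilinMap.toQuadraticMap_apply, LinearMap.smul_apply, LinearMap.smul_apply, LinearMap.compl₁₂_apply,
    LinearMap.comp_apply, hL, smul_eq_mul, neg_mul]

include hc₀ hsupp hq in
/-- **P6's hypothesis `hD` from a root family conjugated onto Siegel unipotents.**  If `g₀ · π(p t) · g₀⁻¹ = n(t • c₀)` for
all `t` and `Λ` is an eigenvector of every `op(p t)`, then `D = Λ ∘ M₀⁻¹` satisfies, with `Q ξ := −½ β(ξ ⊔ 0, c₀ (ξ ⊔ 0))`:
`∀ t, ∃ κ, ∀ Φ Ψ, (∀ x, Ψ x = ψ(t · Q(x|ι₁)) Φ x) → D Ψ = κ · D Φ`. [cite: MoeglinVignerasWaldspurger1987, Chap. 2 II.1 (A), II.6] -/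
theorem eigen_family_of_conj_unipotentSp (hU : ImplementerUniqueUpToScalar (schrodingerSB β ψ hψ hβ))
    (q : MpPsi (schrodingerSB β ψ hψ hβ)) (p : R → MpPsi (schrodingerSB β ψ hψ hβ))
    (h : ∀ t : R, MpPsi.proj _ q * MpPsi.proj _ (p t) * (MpPsi.proj _ q)⁻¹ =
      unipotentSp β (t • c₀) (symm_smul_of_symm β c₀ hc₀ t))
    (Λ : SchwartzBruhat (ι → R) →ₗ[ℂ] ℂ) (hΛ : ∀ t : R, ∃ κ : ℂ, ∀ f, Λ (MpPsi.toOp _ (p t) f) = κ • Λ f) (t : R) :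
    ∃ κ : ℂ, ∀ Φ Ψ : SchwartzBruhat (ι → R),
      (∀ x, (Ψ : (ι → R) → ℂ) x =
        ((ψ (t * -(⅟(2 : R) * β (glue e (resL e x) 0) (c₀ (glue e (resL e x) 0)))) : Circle) : ℂ) *
          (Φ : (ι → R) → ℂ) x) →
        Λ ((MpPsi.toOp _ q).symm Ψ) = κ * Λ ((MpPsi.toOp _ q).symm Φ) := by
  obtain ⟨κ, hκ⟩ := hΛ t
  obtain ⟨c, hc⟩ := exists_eigen_of_conj_unipotentSp β ψ hψ hβ hU q (p t) (t • c₀) (symm_smul_of_symm β c₀ hc₀ t) (hq t)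
    (h t) Λ κ hκ
  refine ⟨(c : ℂ) * κ, fun Φ Ψ hΦΨ => hc Φ Ψ fun x => ?_⟩
  rw [hΦΨ x, neg_half_smul_eq_mul_resL e β c₀ hsupp]

include hc₀ hsupp hq in
/-- **P6's hypothesis `hDF` from a root family conjugated onto `w n(t • c₀) w⁻¹`, `w` implemented by `ℱ`.**
With `Q ξ := −½ β(ξ ⊔ 0, c₀ (ξ ⊔ 0))`: `∀ t, ∃ κ, ∀ Φ Ψ, (∀ x, Ψ x = ψ(t · Q(x|ι₁)) Φ x) → D(ℱ Ψ) = κ · D(ℱ Φ)`.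
[cite: MoeglinVignerasWaldspurger1987, Chap. 2 II.1 (A), II.6] -/
theorem eigen_family_of_conj_weyl_unipotentSp (hU : ImplementerUniqueUpToScalar (schrodingerSB β ψ hψ hβ))
    (q : MpPsi (schrodingerSB β ψ hψ hβ)) (p : R → MpPsi (schrodingerSB β ψ hψ hβ)) (w : symplecticGroup (polar β))
    (ℱ : SchwartzBruhat (ι → R) ≃ₗ[ℂ] SchwartzBruhat (ι → R))
    (hwF : Implements (schrodingerSB β ψ hψ hβ) (ofSymplectic (polar β) w) ℱ)
    (h : ∀ t : R, MpPsi.proj _ q * MpPsi.proj _ (p t) * (MpPsi.proj _ q)⁻¹ =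
      w * unipotentSp β (t • c₀) (symm_smul_of_symm β c₀ hc₀ t) * w⁻¹)
    (Λ : SchwartzBruhat (ι → R) →ₗ[ℂ] ℂ) (hΛ : ∀ t : R, ∃ κ : ℂ, ∀ f, Λ (MpPsi.toOp _ (p t) f) = κ • Λ f) (t : R) :
    ∃ κ : ℂ, ∀ Φ Ψ : SchwartzBruhat (ι → R),
      (∀ x, (Ψ : (ι → R) → ℂ) x =
        ((ψ (t * -(⅟(2 : R) * β (glue e (resL e x) 0) (c₀ (glue e (resL e x) 0)))) : Circle) : ℂ) *
          (Φ : (ι → R) → ℂ) x) →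
        Λ ((MpPsi.toOp _ q).symm (ℱ Ψ)) = κ * Λ ((MpPsi.toOp _ q).symm (ℱ Φ)) := by
  obtain ⟨κ, hκ⟩ := hΛ t
  obtain ⟨c, hc⟩ := exists_eigen_of_conj_weyl_unipotentSp β ψ hψ hβ hU q (p t) w ℱ hwF (t • c₀)
    (symm_smul_of_symm β c₀ hc₀ t) (hq t) (h t) Λ κ hκ
  refine ⟨(c : ℂ) * κ, fun Φ Ψ hΦΨ => hc Φ Ψ fun x => ?_⟩
  rw [hΦΨ x, neg_half_smul_eq_mul_resL e β c₀ hsupp]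

end Coordinates

end Literature.RepresentationTheory.HeisenbergGroup

end
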